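import Summits.Ventures.PercRepro.S1DisjointSumU

/-!
# PercRepro — THE `Y`-SET OF A DISJOINT SUM IS A CONVOLUTION OF THE PARTS' RANK PROFILES (p2, gen 27;
SUBCLAIM-S1 §6.10 (xvii)(a))

The `Y` half of the exact factorisation: `#Y(M ⊕ N; p, q) = Σ_{q < a₁ + a₂ < p} f_M(a₁) · f_N(a₂)` with
`f_M(a) = #{A ⊆ M.E : ρ(A) = a}`, from `disjointSum_mem_Y_iff` (which slices occur), `ncard_trace_slices_eq_mul`
(each slice is a product) and `Set.Finite.ncard_biUnion`. Nothing is claimed about any cell.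

* `rankSet` — the rank-level set `{A ⊆ M.E : ρ(A) = a}`; `ySlice` — the slice with prescribed trace ranks;
* `disjointSum_ncard_ySlice_eq_mul` — a slice is a product; `ySet_eq_biUnion_ySlice` — the `Y`-set is the union of
  the slices with `q < a₁ + a₂ < p`;
* **`disjointSum_ncard_Y_eq_finsum`** — the convolution formula.
Axioms: standard.
-/

open scoped Matroid

namespace PercRepro

namespace S1

open Set

variable {α : Type}

/-- The rank-level set of `M`: the subsets of `E` of rank `a`. -/
def rankSet (M : Matroid α) (a : ℕ) : Set (Set α) := {A : Set α | A ⊆ M.E ∧ M.eRk A = a}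

/-- The slice of the subsets of `M.E ∪ N.E` with trace ranks `a₁`, `a₂`. -/
def ySlice (M N : Matroid α) (a₁ a₂ : ℕ) : Set (Set α) :=
  {A : Set α | A ⊆ M.E ∪ N.E ∧ M.eRk (A ∩ M.E) = a₁ ∧ N.eRk (A ∩ N.E) = a₂}

/-- **A slice with prescribed trace ranks is a product of rank-level sets.** -/
theorem disjointSum_ncard_ySlice_eq_mul (M N : Matroid α) (h : Disjoint M.E N.E) (a₁ a₂ : ℕ) :
    (ySlice M N a₁ a₂).ncard = (rankSet M a₁).ncard * (rankSet N a₂).ncard := by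
  rw [← ncard_trace_slices_eq_mul h (rankSet M a₁) (rankSet N a₂) (fun A hA => hA.1) (fun A hA => hA.1)]
  congr 1
  ext A
  simp only [ySlice, rankSet, mem_setOf_eq]
  constructor
  · rintro ⟨hA, h1, h2⟩
    exact ⟨hA, ⟨inter_subset_right, h1⟩, ⟨inter_subset_right, h2⟩⟩
  · rintro ⟨hA, ⟨-, h1⟩, ⟨-, h2⟩⟩
    exact ⟨hA, h1, h2⟩

/-- **The `Y`-set of a disjoint sum is the union of its slices** with `q < a₁ + a₂ < p`. -/
theorem ySet_eq_biUnion_ySlice (M N : Matroid α) [M.Finite] [N.Finite] (h : Disjoint M.E N.E) (p q : ℕ) :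
    {A : Set α | A ⊆ (M.disjointSum N h).E ∧ (q : ℕ∞) < (M.disjointSum N h).eRk A ∧
        (M.disjointSum N h).eRk A < p} =
      ⋃ x ∈ (((Finset.range p ×ˢ Finset.range p).filter (fun x : ℕ × ℕ => q < x.1 + x.2 ∧ x.1 + x.2 < p) :
          Finset (ℕ × ℕ)) : Set (ℕ × ℕ)), ySlice M N x.1 x.2 := by
  ext A
  simp only [mem_setOf_eq, mem_iUnion, Finset.mem_coe, Finset.mem_filter, Finset.mem_product, Finset.mem_range,
    exists_prop, ySlice]
  rw [disjointSum_mem_Y_iff M N h p q A]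
  constructor
  · rintro ⟨hA, a₁, a₂, hq, hp, h1, h2⟩
    exact ⟨(a₁, a₂), ⟨⟨by omega, by omega⟩, hq, hp⟩, hA, h1, h2⟩
  · rintro ⟨⟨a₁, a₂⟩, ⟨-, hq, hp⟩, hA, h1, h2⟩
    exact ⟨hA, a₁, a₂, hq, hp, h1, h2⟩

/-- **THE CONVOLUTION FORMULA FOR `Y`**: `#Y(M ⊕ N; p, q) = Σ_{q < a₁ + a₂ < p} f_M(a₁) · f_N(a₂)`. -/
theorem disjointSum_ncard_Y_eq_finsum (M N : Matroid α) [M.Finite] [N.Finite] (h : Disjoint M.E N.E)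
    (p q : ℕ) :
    {A : Set α | A ⊆ (M.disjointSum N h).E ∧ (q : ℕ∞) < (M.disjointSum N h).eRk A ∧
        (M.disjointSum N h).eRk A < p}.ncard =
      ∑ᶠ x ∈ (((Finset.range p ×ˢ Finset.range p).filter (fun x : ℕ × ℕ => q < x.1 + x.2 ∧ x.1 + x.2 < p) :
          Finset (ℕ × ℕ)) : Set (ℕ × ℕ)), (rankSet M x.1).ncard * (rankSet N x.2).ncard := by
  rw [ySet_eq_biUnion_ySlice M N h p q]
  set T : Set (ℕ × ℕ) := (((Finset.range p ×ˢ Finset.range p).filter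
    (fun x : ℕ × ℕ => q < x.1 + x.2 ∧ x.1 + x.2 < p) : Finset (ℕ × ℕ)) : Set (ℕ × ℕ)) with hT
  have hfin : T.Finite := Finset.finite_toSet _
  have hslice_fin : ∀ x ∈ T, (ySlice M N x.1 x.2).Finite := fun x _ =>
    (M.ground_finite.union N.ground_finite).finite_subsets.subset (fun A hA => hA.1)
  have hdisj : T.PairwiseDisjoint (fun x : ℕ × ℕ => ySlice M N x.1 x.2) := by
    intro x _ y _ hxy
    rw [Function.onFun, Set.disjoint_left]
    rintro A ⟨-, hx1, hx2⟩ ⟨-, hy1, hy2⟩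
    apply hxy
    have e1 : x.1 = y.1 := by
      have := hx1.symm.trans hy1
      exact_mod_cast this
    have e2 : x.2 = y.2 := by
      have := hx2.symm.trans hy2
      exact_mod_cast this
    exact Prod.ext e1 e2
  rw [Set.Finite.ncard_biUnion hfin hslice_fin hdisj]
  apply finsum_mem_congr rfl
  intro x _
  exact disjointSum_ncard_ySlice_eq_mul M N h x.1 x.2

end S1

end PercRepro
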